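import Literature.AlgebraicGeometry.Morphisms.ContainmentLocusFiniteFlat
import Literature.AlgebraicGeometry.AbelianSchemes.AbelianSchemeOverMulNEtale
import Mathlib.CategoryTheory.Monoidal.Cartesian.Over
import Mathlib.CategoryTheory.Monoidal.Cartesian.Grp
import HarnessLib

/-!
# «`φ = ψ`», «`φ` kills `G`», «a point lands in a closed subscheme» are closed conditions on the base (consumer wrappers)

Topic `Literature/AlgebraicGeometry/GroupSchemes`; theorems only (no definition, no named fact, no instance, no notation,
no `sorry`).  Cell hodgecm-mathlib, F-DAG (h6) consumer wrappers over the finite-flat containment road (★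
`Morphisms/IdealSheafLeKerLocal`, ★ `Morphisms/ContainmentChartFiniteFlat`, ★ `Morphisms/ContainmentLocusFiniteFlat`, ★
`Morphisms/EqualizerLocusClosed`, ★ `Morphisms/ContainmentLocusClosed`), in the `Over S` / Mathlib `Over.pullback` /
`Hom.group` dialect of the cell's group-scheme and abelian-scheme files.  Named consumers: F-10 (b) level descent
(«a level structure compatible with a given one is a closed condition»), (h9) `K_m(λ) ⊆ A[m]`-type loci, F-6 law identities.
HC_CM is proved only modulo the 7 printed citations until rung 0 closes; nothing here is about HC.

For `S`-schemes `G Y : Over S` with `G ⟶ S` FINITE AND FLAT over a locally noetherian `S` (flavour (i); or affine with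
finite projective affine charts, flavour (ii), [GortzWedhorn2020] Def. 12.18) and `Y ⟶ S` SEPARATED:

* §1 **«`φ = ψ`» is a closed subscheme `V(E) ⊆ S`**: `exists_idealSheafData_iff_pullback_map_eq_of_isFinite_of_flat` /
  `…_of_finite_projective_app` — an ideal sheaf `E` with, for every `b : T ⟶ S`, «`b` factors through `V(E)`» ↔
  «`E ≤ b.ker`» ↔ «`(Over.pullback b).map φ = (Over.pullback b).map ψ`»; `idealSheafData_eq_of_iff_pullback_map_eq`
  (uniqueness of `E`);
* §2 **«`φ` kills `G`»** (`[GrpObj Y]`; e.g. «`K ⊆ ker φ`» for a finite flat subgroup scheme `K`):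
  `exists_idealSheafData_iff_pullback_map_eq_one_of_isFinite_of_flat` / `…_of_finite_projective_app` with right side
  `(Over.pullback b).map φ = (Over.pullback b).map 1` (rewrite to the unit of `G_T ⟶ Y_T` for your group structure on
  `Y_T` with Mathlib `Functor.map_one (Over.pullback b)`); `eq_one_iff_le_ker_id`;
* §3 **«a `T`-point `b ≫ σ` lands in a closed subscheme `K ↪ G`»** (no finiteness): `ker_le_ker_comp_iff_comap_le_ker`,
  `exists_comp_eq_comp_iff_exists_comp_subschemeι_eq` — represented by `σ⁻¹K = V(𝓘_K.comap σ)`;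
* §4 **the instance `A[N] ⟶ S`** of an abelian scheme (`N` invertible on `S`: finite étale, ★
  `isFinite_fst_unit_pow_id` / `etale_fst_unit_pow_id`): `isFinite_and_flat_torsion_hom`,
  `exists_idealSheafData_iff_pullback_map_eq_torsion` («two `S`-morphisms out of `A[N]` into a separated `S`-scheme agree»
  is a closed subscheme of `S`);
* §5 **sections** (no finiteness): `pullback_map_eq_iff_ker_le_of_section`, `forall_pullback_map_eq_iff_iSup_ker_le`,
  `exists_comp_subschemeι_eq_iff_forall_pullback_map_eq` — a tuple of pairs of sections `σᵢ τᵢ : 𝟙_ ⟶ Y` agrees after base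
  change along `b` iff `b` factors through `V(⨆ᵢ 𝓘_{Eq(σᵢ,τᵢ)})` (F-10 (b)'s reading; the `AbelianSchemeOver`-typed form is ★
  `SectionEqualityLocus`).

## References
* [GortzWedhorn2020] U. Görtz, T. Wedhorn, *Algebraic Geometry I: Schemes*, 2nd ed. (2020): Definition/Proposition 9.7 (ii)
  (`Eq(f,g) ⊆ X` closed for `Y/S` separated), Definition 12.18 and Proposition 12.19 (pp. 331–332) (finite locally free
  morphisms), Section (4.11) (inverse images of subschemes).
* [MumfordFogartyKirwan1994] D. Mumford, J. Fogarty, F. Kirwan, *Geometric Invariant Theory*, 3rd ed. (1994), Ch. 6 §3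
  Prop. 6.16 (p. 126), Ch. 6 §2 Lemma 6.12 (p. 122) (`X[N]` finite over `S`).
* [BLRNeronModels1990] S. Bosch, W. Lütkebohmert, M. Raynaud, *Néron Models* (1990), §7.3 Lemma 2 (b) (p. 180) (`_N G` étale).
-/

noncomputable section

-- `TopCat.Presheaf`/`Scheme.Modules` are not reducible (as in Mathlib's `AlgebraicGeometry/Modules`).
set_option backward.isDefEq.respectTransparency false

open CategoryTheory CategoryTheory.Limits AlgebraicGeometry TopologicalSpace Opposite MonoidalCategory
  CartesianMonoidalCategory

universe u

namespace Literature.AlgebraicGeometry.GroupSchemes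

open Literature.AlgebraicGeometry.Morphisms Literature.AlgebraicGeometry.Modules

/-! ## §1 «`φ = ψ`» is a closed subscheme of the base, for a finite flat source -/

section Eq

variable {S : Scheme.{u}} {G Y : Over S} (φ ψ : G ⟶ Y)

/-- **«`φ = ψ`» IS A CLOSED SUBSCHEME OF THE BASE** (finite flat source over a locally noetherian base, separated target):
for `S`-morphisms `φ ψ : G ⟶ Y` with `G ⟶ S` finite and flat, `S` locally noetherian and `Y ⟶ S` separated, there is an
ideal sheaf `E` on `S` such that for every `b : T ⟶ S`: `b` factors through the closed subscheme `V(E) ⊆ S` iff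
`E ≤ b.ker` iff the base changes agree, `φ_T = ψ_T` (Mathlib `Over.pullback b`).  (★ `ContainmentLocusFiniteFlat` + ★
`EqualizerLocusClosed`.) [cite: GortzWedhorn2020, Definition/Proposition 9.7 (ii)]
[cite: MumfordFogartyKirwan1994, Ch. 6 §3 Prop. 6.16 (p. 126)] -/
theorem exists_idealSheafData_iff_pullback_map_eq_of_isFinite_of_flat [IsFinite G.hom] [Flat G.hom]
    [IsLocallyNoetherian S] [IsSeparated Y.hom] :
    ∃ E : S.IdealSheafData, ∀ ⦃T : Scheme.{u}⦄ (b : T ⟶ S),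
      ((∃ b' : T ⟶ E.subscheme, b' ≫ E.subschemeι = b) ↔ (Over.pullback b).map φ = (Over.pullback b).map ψ) ∧
      (E ≤ b.ker ↔ (Over.pullback b).map φ = (Over.pullback b).map ψ) := by
  obtain ⟨J, hJ⟩ := exists_idealSheafData_le_ker_iff_le_ker_fst_of_finite_projective_app G.hom
    (equalizer.ι φ ψ).left.ker (finite_projective_app_of_isFinite_of_flat G.hom)
  exact ⟨J, fun _ b => ⟨exists_comp_subschemeι_eq_iff_pullback_map_eq_of_containment φ ψ J hJ b,
    le_ker_iff_pullback_map_eq_of_containment φ ψ J hJ b⟩⟩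

/-- The same for `G ⟶ S` affine with finite projective affine charts (Görtz–Wedhorn I Def. 12.18: finite locally free;
any base). [cite: GortzWedhorn2020, Definition 12.18 and Proposition 12.19 (pp. 331–332)]
[cite: MumfordFogartyKirwan1994, Ch. 6 §3 Prop. 6.16 (p. 126)] -/
theorem exists_idealSheafData_iff_pullback_map_eq_of_finite_projective_app [IsAffineHom G.hom]
    (hp : ∀ s : S, ∃ W : S.Opens, s ∈ W ∧ IsAffineOpen W ∧
      letI := (G.hom.app W).hom.toAlgebra
      Module.Finite Γ(S, W) Γ(G.left, G.hom ⁻¹ᵁ W) ∧ Module.Projective Γ(S, W) Γ(G.left, G.hom ⁻¹ᵁ W))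
    [IsSeparated Y.hom] :
    ∃ E : S.IdealSheafData, ∀ ⦃T : Scheme.{u}⦄ (b : T ⟶ S),
      ((∃ b' : T ⟶ E.subscheme, b' ≫ E.subschemeι = b) ↔ (Over.pullback b).map φ = (Over.pullback b).map ψ) ∧
      (E ≤ b.ker ↔ (Over.pullback b).map φ = (Over.pullback b).map ψ) := by
  obtain ⟨J, hJ⟩ := exists_idealSheafData_le_ker_iff_le_ker_fst_of_finite_projective_app G.hom
    (equalizer.ι φ ψ).left.ker hp
  exact ⟨J, fun _ b => ⟨exists_comp_subschemeι_eq_iff_pullback_map_eq_of_containment φ ψ J hJ b,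
    le_ker_iff_pullback_map_eq_of_containment φ ψ J hJ b⟩⟩

/-- **The equality locus is unique**: two ideal sheaves representing «`φ_T = ψ_T`» coincide (★
`idealSheafData_eq_of_forall_le_ker_iff`). [cite: GortzWedhorn2020, Definition/Proposition 9.7 (ii)] -/
theorem idealSheafData_eq_of_iff_pullback_map_eq {E E' : S.IdealSheafData}
    (hE : ∀ ⦃T : Scheme.{u}⦄ (b : T ⟶ S), E ≤ b.ker ↔ (Over.pullback b).map φ = (Over.pullback b).map ψ)
    (hE' : ∀ ⦃T : Scheme.{u}⦄ (b : T ⟶ S), E' ≤ b.ker ↔ (Over.pullback b).map φ = (Over.pullback b).map ψ) :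
    E = E' :=
  idealSheafData_eq_of_forall_le_ker_iff fun _ b => (hE b).trans (hE' b).symm

end Eq

/-! ## §2 «`φ` kills `G`» (`φ = 1`, e.g. «`K ⊆ ker φ`» for a finite flat subgroup `K`) is a closed subscheme of the base -/

section One

open scoped MonObj

variable {S : Scheme.{u}} {G Y : Over S} [GrpObj Y] (φ : G ⟶ Y)

/-- **«`φ` KILLS `G`» IS A CLOSED SUBSCHEME OF THE BASE**: for an `S`-morphism `φ : G ⟶ Y` into a separated `S`-group
scheme with `G ⟶ S` finite and flat (`S` locally noetherian) — e.g. the restriction of a homomorphism to a finite flat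
subgroup scheme `K` («`K ⊆ ker φ`») — there is an ideal sheaf `E` on `S` with: `b : T ⟶ S` factors through `V(E)` iff
`E ≤ b.ker` iff `φ_T = 1_T`, the base change of the unit `1 = toUnit ≫ η` of Mathlib's `Hom.group` (rewrite `1_T` to the
unit of `G_T ⟶ Y_T` for your group structure on `Y_T` with `Functor.map_one (Over.pullback b)`, as ★
`AbelianSchemeMorphismSpread.pullback_map_one`). [cite: GortzWedhorn2020, Definition/Proposition 9.7 (ii)]
[cite: MumfordFogartyKirwan1994, Ch. 6 §3 Prop. 6.16 (p. 126)] -/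
theorem exists_idealSheafData_iff_pullback_map_eq_one_of_isFinite_of_flat [IsFinite G.hom] [Flat G.hom]
    [IsLocallyNoetherian S] [IsSeparated Y.hom] :
    ∃ E : S.IdealSheafData, ∀ ⦃T : Scheme.{u}⦄ (b : T ⟶ S),
      ((∃ b' : T ⟶ E.subscheme, b' ≫ E.subschemeι = b) ↔
          (Over.pullback b).map φ = (Over.pullback b).map (1 : G ⟶ Y)) ∧
      (E ≤ b.ker ↔ (Over.pullback b).map φ = (Over.pullback b).map (1 : G ⟶ Y)) :=
  exists_idealSheafData_iff_pullback_map_eq_of_isFinite_of_flat φ (1 : G ⟶ Y)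

/-- The same for `G ⟶ S` affine with finite projective affine charts (any base).
[cite: GortzWedhorn2020, Definition 12.18 and Proposition 12.19 (pp. 331–332)]
[cite: MumfordFogartyKirwan1994, Ch. 6 §3 Prop. 6.16 (p. 126)] -/
theorem exists_idealSheafData_iff_pullback_map_eq_one_of_finite_projective_app [IsAffineHom G.hom]
    (hp : ∀ s : S, ∃ W : S.Opens, s ∈ W ∧ IsAffineOpen W ∧
      letI := (G.hom.app W).hom.toAlgebra
      Module.Finite Γ(S, W) Γ(G.left, G.hom ⁻¹ᵁ W) ∧ Module.Projective Γ(S, W) Γ(G.left, G.hom ⁻¹ᵁ W))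
    [IsSeparated Y.hom] :
    ∃ E : S.IdealSheafData, ∀ ⦃T : Scheme.{u}⦄ (b : T ⟶ S),
      ((∃ b' : T ⟶ E.subscheme, b' ≫ E.subschemeι = b) ↔
          (Over.pullback b).map φ = (Over.pullback b).map (1 : G ⟶ Y)) ∧
      (E ≤ b.ker ↔ (Over.pullback b).map φ = (Over.pullback b).map (1 : G ⟶ Y)) :=
  exists_idealSheafData_iff_pullback_map_eq_of_finite_projective_app φ (1 : G ⟶ Y) hp

/-- «`φ` kills `G`» globally is detected on the locus: `φ = 1 ↔ E = ⊥`-style reading at `b := 𝟙 S` — `φ = 1` iff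
`E ≤ (𝟙 S).ker = ⊥`, i.e. iff `V(E) = S`. [cite: GortzWedhorn2020, Definition/Proposition 9.7 (ii)] -/
theorem eq_one_iff_le_ker_id {E : S.IdealSheafData}
    (hE : ∀ ⦃T : Scheme.{u}⦄ (b : T ⟶ S), E ≤ b.ker ↔ (Over.pullback b).map φ = (Over.pullback b).map (1 : G ⟶ Y)) :
    (Over.pullback (𝟙 S)).map φ = (Over.pullback (𝟙 S)).map (1 : G ⟶ Y) ↔ E = ⊥ := by
  rw [← hE (𝟙 S), Scheme.Hom.ker_eq_bot_of_isIso, le_bot_iff]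

end One

/-! ## §3 «a `T`-point lands in a closed subscheme» is closed (no finiteness) -/

section Mem

variable {K G S' T : Scheme.{u}} (i : K ⟶ G) (σ : S' ⟶ G) (b : T ⟶ S')

/-- **«`b ≫ σ` lands in the closed subscheme `K ↪ G`» iff `b` factors through `σ⁻¹K = V(𝓘_K.comap σ)`**, ideal form:
`i.ker ≤ (b ≫ σ).ker ↔ i.ker.comap σ ≤ b.ker` (Mathlib `Scheme.Hom.ker_comp` / `map_ker`, Galois connection
`le_map_iff_comap_le`).  For a section `σ` of `G → S'` and a closed subgroup scheme `K`, this is «`σ_T ∈ K_T`» as a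
closed condition on `S'`. [cite: GortzWedhorn2020, Section (4.11)] -/
theorem ker_le_ker_comp_iff_comap_le_ker : i.ker ≤ (b ≫ σ).ker ↔ i.ker.comap σ ≤ b.ker := by
  rw [← Scheme.IdealSheafData.map_ker, Scheme.IdealSheafData.le_map_iff_comap_le]

/-- Factorisation form: `b ≫ σ` factors through the closed immersion `i : K ⟶ G` iff `b` factors through the closed
subscheme `V(𝓘_K.comap σ) ⊆ S'` (Mathlib `IsClosedImmersion.lift`). [cite: GortzWedhorn2020, Section (4.11)] -/
theorem exists_comp_eq_comp_iff_exists_comp_subschemeι_eq [IsClosedImmersion i] :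
    (∃ k : T ⟶ K, k ≫ i = b ≫ σ) ↔
      ∃ b' : T ⟶ (i.ker.comap σ).subscheme, b' ≫ (i.ker.comap σ).subschemeι = b := by
  constructor
  · rintro ⟨k, hk⟩
    have h : i.ker ≤ (b ≫ σ).ker := hk ▸ Scheme.Hom.le_ker_comp _ _
    rw [ker_le_ker_comp_iff_comap_le_ker] at h
    exact ⟨IsClosedImmersion.lift (i.ker.comap σ).subschemeι b
      (by rwa [Scheme.IdealSheafData.ker_subschemeι]), IsClosedImmersion.lift_fac _ _ _⟩
  · rintro ⟨b', hb'⟩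
    have h : i.ker.comap σ ≤ b.ker :=
      hb' ▸ (Scheme.IdealSheafData.ker_subschemeι _).symm.trans_le (Scheme.Hom.le_ker_comp _ _)
    rw [← ker_le_ker_comp_iff_comap_le_ker] at h
    exact ⟨IsClosedImmersion.lift i (b ≫ σ) h, IsClosedImmersion.lift_fac _ _ _⟩

end Mem

/-! ## §4 The instance `A[N] → S` (finite étale, hence finite flat, for `N` invertible on `S`) -/

section Torsion

open scoped MonObj

variable {S : Scheme.{u}} (A : AbelianSchemes.AbelianSchemeOver S)

/-- **`A[N] → S` is finite and flat for `N` invertible on `S`** (★ `isFinite_fst_unit_pow_id`, ★ `etale_fst_unit_pow_id`;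
étale ⇒ flat), packaged as the `Over S`-object `Over.mk (X[N] ⟶ S)` so that §§1–2 apply to morphisms out of the
`N`-torsion (level structures, `K_m(λ) ⊆ A[m]`, …) over a locally noetherian base.
[cite: MumfordFogartyKirwan1994, Ch. 6 §2 Lemma 6.12 (p. 122)] [cite: BLRNeronModels1990, §7.3 Lemma 2 (b) (p. 180)] -/
theorem isFinite_and_flat_torsion_hom {N : ℕ} (hN : ∀ s : S, (N : S.residueField s) ≠ 0) :
    IsFinite (Over.mk (X := S) (pullback.fst (η[A.X] : 𝟙_ (Over S) ⟶ A.X).left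
        ((((𝟙 A.X : A.X ⟶ A.X) ^ N) : A.X ⟶ A.X).left))).hom ∧
      Flat (Over.mk (X := S) (pullback.fst (η[A.X] : 𝟙_ (Over S) ⟶ A.X).left
        ((((𝟙 A.X : A.X ⟶ A.X) ^ N) : A.X ⟶ A.X).left))).hom := by
  refine ⟨A.isFinite_fst_unit_pow_id hN, ?_⟩
  have h := A.etale_fst_unit_pow_id hN
  exact (Etale.iff_flat_and_formallyUnramified.mp h).1

/-- **«two `S`-morphisms out of `A[N]` into a separated `S`-scheme agree» is a closed subscheme of `S`** (`N` invertible on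
`S`, `S` locally noetherian; e.g. two level-`N` structures read as morphisms, or `K_m(λ)`-type conditions): §1 at
`G := A[N]`. [cite: MumfordFogartyKirwan1994, Ch. 6 §3 Prop. 6.16 (p. 126)] [cite: GortzWedhorn2020, Definition/Proposition 9.7 (ii)] -/
theorem exists_idealSheafData_iff_pullback_map_eq_torsion [IsLocallyNoetherian S] {N : ℕ}
    (hN : ∀ s : S, (N : S.residueField s) ≠ 0) {Y : Over S} [IsSeparated Y.hom]
    (φ ψ : Over.mk (X := S) (pullback.fst (η[A.X] : 𝟙_ (Over S) ⟶ A.X).left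
        ((((𝟙 A.X : A.X ⟶ A.X) ^ N) : A.X ⟶ A.X).left)) ⟶ Y) :
    ∃ E : S.IdealSheafData, ∀ ⦃T : Scheme.{u}⦄ (b : T ⟶ S),
      ((∃ b' : T ⟶ E.subscheme, b' ≫ E.subschemeι = b) ↔ (Over.pullback b).map φ = (Over.pullback b).map ψ) ∧
      (E ≤ b.ker ↔ (Over.pullback b).map φ = (Over.pullback b).map ψ) := by
  obtain ⟨hfin, hflat⟩ := isFinite_and_flat_torsion_hom A hN
  haveI := hfin
  haveI := hflat
  exact exists_idealSheafData_iff_pullback_map_eq_of_isFinite_of_flat φ ψ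

end Torsion

/-! ## §5 Sections: «`σ_T = τ_T`» for tuples of sections of a separated `Y ⟶ S` (no finiteness) -/

section Sections

variable {S : Scheme.{u}} {Y : Over S} [IsSeparated Y.hom]

/-- For SECTIONS `σ τ : 𝟙_ ⟶ Y` (morphisms from the terminal `S`-scheme `S` itself) the base changes along `b : T ⟶ S`
agree iff `b ≫ σ = b ≫ τ`, iff `b` kills the ideal of the equaliser `Eq(σ,τ) ⊆ S` (★ `EqualizerLocusClosed` at
`X := 𝟙_ (Over S)`, whose structure morphism is `𝟙 S`). [cite: GortzWedhorn2020, Definition/Proposition 9.7 (ii)] -/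
theorem pullback_map_eq_iff_ker_le_of_section (σ τ : 𝟙_ (Over S) ⟶ Y) {T : Scheme.{u}} (b : T ⟶ S) :
    (Over.pullback b).map σ = (Over.pullback b).map τ ↔ (equalizer.ι σ τ).left.ker ≤ b.ker := by
  rw [pullback_map_eq_iff_ker_equalizer_ι_le]
  -- the projection `S ×_S T ⟶ S` is `pr₂ ≫ b` with `pr₂` an isomorphism
  have hfst : pullback.fst (𝟙_ (Over S)).hom b = pullback.snd (𝟙_ (Over S)).hom b ≫ b := by
    rw [← pullback.condition]
    exact (Category.comp_id _).symm
  haveI : IsIso (pullback.snd (𝟙_ (Over S)).hom b) := by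
    change IsIso (pullback.snd (𝟙 S) b)
    infer_instance
  rw [hfst, Scheme.Hom.ker_comp_of_isIso]

/-- **A TUPLE of pairs of sections agrees after base change along `b` iff `b` factors through the closed subscheme
`⋂ᵢ Eq(σᵢ, τᵢ) = V(⨆ᵢ 𝓘_{Eq(σᵢ,τᵢ)}) ⊆ S`** (F-10 (b): two level structures — `2g`-tuples of torsion sections — agree on a
CLOSED subscheme of the base; the `AbelianSchemeOver`-typed form is ★ `SectionEqualityLocus`).
[cite: GortzWedhorn2020, Definition/Proposition 9.7 (ii)] [cite: MumfordFogartyKirwan1994, Ch. 6 §3 Prop. 6.16 (p. 126)] -/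
theorem forall_pullback_map_eq_iff_iSup_ker_le {J : Type*} (σ τ : J → (𝟙_ (Over S) ⟶ Y)) {T : Scheme.{u}}
    (b : T ⟶ S) :
    (∀ i, (Over.pullback b).map (σ i) = (Over.pullback b).map (τ i)) ↔
      (⨆ i, (equalizer.ι (σ i) (τ i)).left.ker) ≤ b.ker := by
  rw [iSup_le_iff]
  exact forall_congr' fun i => pullback_map_eq_iff_ker_le_of_section (σ i) (τ i) b

/-- Factorisation form of `forall_pullback_map_eq_iff_iSup_ker_le`: `b` factors through the closed subscheme
`V(⨆ᵢ 𝓘_{Eq(σᵢ,τᵢ)})` iff all `σᵢ, τᵢ` agree after base change along `b`. [cite: GortzWedhorn2020, Definition/Proposition 9.7 (ii)] -/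
theorem exists_comp_subschemeι_eq_iff_forall_pullback_map_eq {J : Type*} (σ τ : J → (𝟙_ (Over S) ⟶ Y))
    {T : Scheme.{u}} (b : T ⟶ S) :
    (∃ b' : T ⟶ (⨆ i, (equalizer.ι (σ i) (τ i)).left.ker).subscheme,
        b' ≫ (⨆ i, (equalizer.ι (σ i) (τ i)).left.ker).subschemeι = b) ↔
      ∀ i, (Over.pullback b).map (σ i) = (Over.pullback b).map (τ i) := by
  rw [forall_pullback_map_eq_iff_iSup_ker_le]
  constructor
  · rintro ⟨b', rfl⟩
    exact (Scheme.IdealSheafData.ker_subschemeι _).symm.trans_le (Scheme.Hom.le_ker_comp _ _)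
  · intro h
    exact ⟨IsClosedImmersion.lift _ b (by rwa [Scheme.IdealSheafData.ker_subschemeι]), IsClosedImmersion.lift_fac _ _ _⟩

end Sections

end Literature.AlgebraicGeometry.GroupSchemes

end
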